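import Literature.Topology.FourManifolds.Morse
import Literature.Topology.FourManifolds.MorseProofs
import Literature.Topology.FourManifolds.MorseTurnAbout
import Literature.Topology.FourManifolds.MorseChartChange
import Mathlib.Analysis.Calculus.FDeriv.Symmetric
import Mathlib.Analysis.Calculus.LocalExtr.Basic
import Mathlib.Topology.Order.LocalExtr
import HarnessLib

/-!
# Minima and maxima of Morse functions: critical points of index `0` and `n`

Topic `Literature/Topology/FourManifolds` (trunk FourManL, notion `kirby_calculus_handles`);
rung **Min/Max** of the DAG of the fact item `provefact-Literature.SPC4.exists_isMorse_isSelfIndexing`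
(see `NiceMorseFunctions.lean`).  Everything in this file is **proved**.

On a manifold without boundary a local minimum `x` of `f` is a critical point, and if `f` is
`C²` there its Hessian is positive semidefinite, so the Morse index (the negative index of
inertia of the Hessian) is `0`; dually (via `f ↦ 0 - f`, "turning about", the tree's
`MorseTurnAbout.lean`) a local maximum of a *Morse* function has index `n = dim M`.  Consequently a Morse function on a nonempty compact
manifold without boundary has at least one critical point of index `0` (where it attains its
minimum) and at least one of index `n` (its maximum):

> Matsumoto, *An introduction to Morse theory* (2001), proof of Thm. 3.35, p. 120: "the number
> of critical points of index `0` cannot be zero, since `M` is compact"; Milnor, *Morse theory*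
> (1963), proof of Thm. 4.1 (Reeb): "the two critical points must be the minimum and maximum
> points"; index of a nondegenerate minimum `= 0`, of a maximum `= n` (Milnor 1963, §2–3).

This is the base of the induction in the one-minimum–one-maximum theorem (Matsumoto Thm. 3.35 /
Milnor 1965 Thm. 8.1), and it is what makes "exactly one" rather than "at most one" critical
point of index `0` and `n` in `Literature.Topology.FourManifolds.exists_isMorse_isSelfIndexing`.

## Contents

* `Literature.Topology.FourManifolds.IsLocalMin.fderiv_fderiv_apply_self_nonneg` — second-order necessary condition in a
  normed space: at a local minimum of a `C²` function `D²F(z)(v,v) ≥ 0`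
  (from Mathlib's `Convex.taylor_approx_two_segment`).
* `Literature.Topology.FourManifolds.IsLocalMin.isMCriticalPt`, `Literature.Topology.FourManifolds.IsLocalMax.isMCriticalPt` — Fermat on a boundaryless
  manifold.
* `Literature.Topology.FourManifolds.IsLocalMin.mhessian_apply_self_nonneg`, `Literature.Topology.FourManifolds.IsLocalMin.morseIndex_eq_zero` — the
  Hessian at a local minimum is positive semidefinite; the Morse index there is `0`.
* `Literature.Topology.FourManifolds.IsMorse.morseIndex_eq_finrank_of_isLocalMax` — for a Morse function the index at a local
  maximum is `dim E`.
* `Literature.Topology.FourManifolds.exists_isMCriticalPt_morseIndex_eq_zero`, `Literature.Topology.FourManifolds.IsMorse.criticalSetOfIndex_zero_nonempty`,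
  `Literature.Topology.FourManifolds.IsMorse.criticalSetOfIndex_finrank_nonempty` and the `ncard` forms
  `Literature.Topology.FourManifolds.IsMorse.one_le_ncard_criticalSetOfIndex_zero`,
  `Literature.Topology.FourManifolds.IsMorse.one_le_ncard_criticalSetOfIndex_finrank` on compact nonempty manifolds without
  boundary; on closed `n`-manifolds (`𝓡 n`) `Literature.Topology.FourManifolds.IsMorse.ncard_criticalSetOfIndex_zero_sub`
  (turning about swaps the counts of index `0` and `n`) and
  `Literature.Topology.FourManifolds.IsMorse.one_le_ncard_criticalSetOfIndex_zero_and_self`.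

## References

* J. Milnor, *Morse theory*, Ann. of Math. Studies 51 (1963), §2 (index), proof of Thm. 4.1.
  [Milnor1963]
* Y. Matsumoto, *An introduction to Morse theory*, Transl. Math. Monogr. 208 (2001), proof of
  Thm. 3.35. [Matsumoto2001]
-/

open scoped Manifold ContDiff Topology
open Set Function Filter Asymptotics

noncomputable section

namespace Literature.Topology.FourManifolds

/-! ### Calculus: the second-order condition at a local minimum -/

section Calculus

variable {E : Type*} [NormedAddCommGroup E] [NormedSpace ℝ E]

/-- **Second-order necessary condition for a local minimum.**  If `F` is `C²` at a local
minimum `z`, then the second derivative is positive semidefinite there: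
`D²F(z)(v, v) ≥ 0` for every `v` (Taylor expansion to order two along `h ↦ z + h v`). [folklore] -/
theorem IsLocalMin.fderiv_fderiv_apply_self_nonneg {F : E → ℝ} {z : E}
    (hF : ContDiffAt ℝ 2 F z) (hmin : IsLocalMin F z) (v : E) :
    0 ≤ fderiv ℝ (fderiv ℝ F) z v v := by
  -- a ball on which `F` is differentiable
  have hev : ∀ᶠ y in 𝓝 z, ContDiffAt ℝ 2 F y := hF.eventually (by simp)
  obtain ⟨δ, hδ, hball⟩ := Metric.eventually_nhds_iff_ball.1 hev
  set s : Set E := Metric.ball z δ with hs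
  have hint : interior s = s := Metric.isOpen_ball.interior_eq
  have hf : ∀ y ∈ interior s, HasFDerivAt F (fderiv ℝ F y) y := fun y hy =>
    ((hball y (hint ▸ hy :)).differentiableAt (by simp)).hasFDerivAt
  have hx : HasFDerivWithinAt (fderiv ℝ F) (fderiv ℝ (fderiv ℝ F) z) (interior s) z :=
    ((hF.fderiv_right (m := 1) (by norm_num)).differentiableAt (by simp)).hasFDerivAt
      |>.hasFDerivWithinAt
  -- rescale `v` into the ball
  set c : ℝ := δ / (2 * (‖v‖ + 1)) with hc
  have hvpos : 0 < ‖v‖ + 1 := by positivity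
  have hcpos : 0 < c := by rw [hc]; positivity
  set w : E := c • v with hw
  have hwnorm : ‖w‖ < δ := by
    rw [hw, norm_smul, Real.norm_of_nonneg hcpos.le, hc]
    calc δ / (2 * (‖v‖ + 1)) * ‖v‖ ≤ δ / (2 * (‖v‖ + 1)) * (‖v‖ + 1) := by
          gcongr; linarith
      _ = δ / 2 := by field_simp
      _ < δ := by linarith
  have hzs : z ∈ s := Metric.mem_ball_self hδ
  have hv0 : z + (0 : E) ∈ interior s := by rw [hint, add_zero]; exact hzs
  have hw' : z + (0 : E) + w ∈ interior s := by
    rw [hint, add_zero, hs, Metric.mem_ball, dist_eq_norm, add_sub_cancel_left]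
    exact hwnorm
  have taylor := Convex.taylor_approx_two_segment (convex_ball z δ) hf hzs hx hv0 hw'
  -- simplify the expansion: `F' z = 0` at the minimum, `F'' 0 w = 0`
  have hfz : fderiv ℝ F z = 0 := hmin.fderiv_eq_zero
  simp only [smul_zero, add_zero, hfz, zero_apply, map_zero, sub_zero] at taylor
  -- it suffices to treat `w = c • v`, `c > 0`
  suffices h : 0 ≤ fderiv ℝ (fderiv ℝ F) z w w by
    rw [hw, map_smul, map_smul, FunLike.coe_smul, Pi.smul_apply, smul_eq_mul,
      smul_eq_mul] at h
    have hc2 : 0 < c * c := mul_pos hcpos hcpos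
    nlinarith [h, hc2, mul_nonneg hcpos.le hcpos.le]
  by_contra hneg
  have hneg : fderiv ℝ (fderiv ℝ F) z w w < 0 := not_le.1 hneg
  set Q : ℝ := fderiv ℝ (fderiv ℝ F) z w w with hQ
  -- the Taylor expansion with `ε = -Q/4` ...
  have h1 : ∀ᶠ h in 𝓝[>] (0 : ℝ),
      ‖F (z + h • w) - F z - (h ^ 2 / 2) • Q‖ ≤ (-Q / 4) * ‖h ^ 2‖ :=
    taylor.def (by linarith)
  -- ... against the local minimum along `h ↦ z + h • w`
  have htend : Tendsto (fun h : ℝ => z + h • w) (𝓝[>] 0) (𝓝 z) := by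
    have : Tendsto (fun h : ℝ => z + h • w) (𝓝 0) (𝓝 (z + (0 : ℝ) • w)) :=
      ((continuous_const.add (continuous_id.smul continuous_const)).tendsto 0)
    rw [zero_smul, add_zero] at this
    exact this.mono_left nhdsWithin_le_nhds
  have h2 : ∀ᶠ h in 𝓝[>] (0 : ℝ), F z ≤ F (z + h • w) := htend.eventually hmin
  have h3 : ∀ᶠ h in 𝓝[>] (0 : ℝ), 0 < h := self_mem_nhdsWithin
  obtain ⟨h, hh1, hh2, hh3⟩ := (h1.and (h2.and h3)).exists
  have hh2' : 0 < h ^ 2 := by positivity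
  rw [Real.norm_of_nonneg hh2'.le] at hh1
  have := (abs_le.1 (Real.norm_eq_abs _ ▸ hh1)).2
  rw [smul_eq_mul] at this
  nlinarith [this, hh2, hh2', hneg]

/-- Dually, at a local maximum of a `C²` function the second derivative is negative
semidefinite. [folklore] -/
theorem IsLocalMax.fderiv_fderiv_apply_self_nonpos {F : E → ℝ} {z : E}
    (hF : ContDiffAt ℝ 2 F z) (hmax : IsLocalMax F z) (v : E) :
    fderiv ℝ (fderiv ℝ F) z v v ≤ 0 := by
  have h := IsLocalMin.fderiv_fderiv_apply_self_nonneg hF.neg hmax.neg v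
  have h1 : (fderiv ℝ fun y => -F y) = fun y => -fderiv ℝ F y := by
    ext y u; rw [fderiv_fun_neg]
  rw [h1, fderiv_fun_neg] at h
  have h2 : (-fderiv ℝ (fderiv ℝ F) z) v v = -(fderiv ℝ (fderiv ℝ F) z v v) := rfl
  rw [h2] at h
  linarith

end Calculus

/-! ### Local extrema on a boundaryless manifold -/

section Manifold

variable {E H : Type*} [NormedAddCommGroup E] [NormedSpace ℝ E] [TopologicalSpace H]
  {I : ModelWithCorners ℝ E H} {M : Type*} [TopologicalSpace M] [ChartedSpace H M]

/-- A local minimum of `f` on `M` is a local minimum of `f` written in the chart at that point. [folklore] -/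
theorem isLocalMin_writtenInExtChartAt {f : M → ℝ} {x : M} (h : IsLocalMin f x) :
    IsLocalMin (writtenInExtChartAt I 𝓘(ℝ, ℝ) x f) (extChartAt I x x) := by
  rw [writtenInExtChartAt_eq_comp_extend_symm]
  have h' : IsLocalMin f ((extChartAt I x).symm (extChartAt I x x)) := by
    rwa [extChartAt_to_inv]
  exact h'.comp_continuous (continuousAt_extChartAt_symm x)

/-- A local maximum of `f` on `M` is a local maximum of `f` written in the chart at that point. [folklore] -/
theorem isLocalMax_writtenInExtChartAt {f : M → ℝ} {x : M} (h : IsLocalMax f x) :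
    IsLocalMax (writtenInExtChartAt I 𝓘(ℝ, ℝ) x f) (extChartAt I x x) := by
  rw [writtenInExtChartAt_eq_comp_extend_symm]
  have h' : IsLocalMax f ((extChartAt I x).symm (extChartAt I x x)) := by
    rwa [extChartAt_to_inv]
  exact h'.comp_continuous (continuousAt_extChartAt_symm x)

variable [I.Boundaryless]

/-- **Fermat's theorem on a manifold without boundary**: a local minimum is a critical point
(Milnor 1963, §2–3; the boundaryless hypothesis is necessary: `x ↦ x` on `[0, 1]`). [folklore] -/
theorem IsLocalMin.isMCriticalPt {f : M → ℝ} {x : M} (h : IsLocalMin f x) :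
    IsMCriticalPt I f x := by
  unfold IsMCriticalPt
  by_cases hd : MDifferentiableAt I 𝓘(ℝ, ℝ) f x
  · rw [hd.mfderiv, ModelWithCorners.Boundaryless.range_eq_univ, fderivWithin_univ]
    exact (isLocalMin_writtenInExtChartAt (I := I) h).fderiv_eq_zero
  · exact mfderiv_zero_of_not_mdifferentiableAt hd

/-- A local maximum on a manifold without boundary is a critical point. [folklore] -/
theorem IsLocalMax.isMCriticalPt {f : M → ℝ} {x : M} (h : IsLocalMax f x) :
    IsMCriticalPt I f x := by
  unfold IsMCriticalPt
  by_cases hd : MDifferentiableAt I 𝓘(ℝ, ℝ) f x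
  · rw [hd.mfderiv, ModelWithCorners.Boundaryless.range_eq_univ, fderivWithin_univ]
    exact (isLocalMax_writtenInExtChartAt (I := I) h).fderiv_eq_zero
  · exact mfderiv_zero_of_not_mdifferentiableAt hd

/-- **The Hessian at a local minimum is positive semidefinite** (for `f` of class `C²` at the
point, on a manifold without boundary; Milnor 1963, §2). [folklore] -/
theorem IsLocalMin.mhessian_apply_self_nonneg {f : M → ℝ} {x : M}
    (hf : ContMDiffAt I 𝓘(ℝ, ℝ) 2 f x) (h : IsLocalMin f x) (v : E) :
    0 ≤ mhessian I f x v v := by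
  have h2 : ContDiffAt ℝ 2 (writtenInExtChartAt I 𝓘(ℝ, ℝ) x f) (extChartAt I x x) := by
    have := (contMDiffAt_iff.1 hf).2
    rwa [ModelWithCorners.Boundaryless.range_eq_univ, contDiffWithinAt_univ] at this
  have key := IsLocalMin.fderiv_fderiv_apply_self_nonneg h2
    (isLocalMin_writtenInExtChartAt (I := I) h) v
  have hdef : mhessian I f x v v =
      fderivWithin ℝ (fderivWithin ℝ (writtenInExtChartAt I 𝓘(ℝ, ℝ) x f) (range I)) (range I)
        (extChartAt I x x) v v := rfl
  rw [hdef]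
  simp only [ModelWithCorners.Boundaryless.range_eq_univ, fderivWithin_univ]
  exact key

/-- **A local minimum has Morse index `0`**: the Hessian there is positive semidefinite, so it
is negative definite on no nonzero subspace (Milnor 1963, §2: index = dimension of a maximal
negative definite subspace). [cite: Milnor1963, §2] -/
theorem IsLocalMin.morseIndex_eq_zero [FiniteDimensional ℝ E] {f : M → ℝ} {x : M}
    (hf : ContMDiffAt I 𝓘(ℝ, ℝ) 2 f x) (h : IsLocalMin f x) : morseIndex I f x = 0 := by
  have hnn : ∀ v, 0 ≤ (mhessian I f x).toQuadraticMap v := fun v => by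
    rw [LinearMap.BilinMap.toQuadraticMap_apply]
    exact IsLocalMin.mhessian_apply_self_nonneg hf h v
  have key := QuadraticForm.sigPos_add_finrank_le_of_nonpos
    (Q := -(mhessian I f x).toQuadraticMap) (V := ⊤)
    (fun v _ => by rw [QuadraticMap.neg_apply, neg_nonpos]; exact hnn v)
  rw [finrank_top, sigPos_neg] at key
  unfold morseIndex
  omega

end Manifold

/-! ### Morse functions: minima have index `0`, maxima have index `n` -/

section Morse

variable {E H : Type*} [NormedAddCommGroup E] [NormedSpace ℝ E] [TopologicalSpace H]
  {I : ModelWithCorners ℝ E H} {M : Type*} [TopologicalSpace M] [ChartedSpace H M]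

/-- A Morse function is `C²`. [cite: Milnor1963, §2] -/
theorem IsMorse.contMDiff_two' {f : M → ℝ} (hf : IsMorse I f) : ContMDiff I 𝓘(ℝ, ℝ) 2 f :=
  hf.contMDiff.of_le (by norm_cast)

/-- A Morse function is `C²` at every point. [cite: Milnor1963, §2] -/
theorem IsMorse.contMDiffAt_two {f : M → ℝ} (hf : IsMorse I f) (x : M) :
    ContMDiffAt I 𝓘(ℝ, ℝ) 2 f x :=
  hf.contMDiff_two' x

variable [I.Boundaryless]

namespace IsMorse

variable {f : M → ℝ}

/-- For a Morse function, a local minimum is a critical point of index `0` (Milnor 1963, §2;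
Matsumoto 2001, proof of Thm. 3.35). [cite: Milnor1963, §2] -/
theorem morseIndex_eq_zero_of_isLocalMin [FiniteDimensional ℝ E] (hf : IsMorse I f) {x : M}
    (h : IsLocalMin f x) : morseIndex I f x = 0 :=
  IsLocalMin.morseIndex_eq_zero (hf.contMDiffAt_two x) h

/-- For a Morse function, a local maximum is a critical point of index `dim E`: it is a local
minimum of the Morse function `0 - f` ("turned about", `MorseTurnAbout.lean`), of index `0`,
and the indices of `f` and `0 - f` at a critical point add up to `dim E` (Milnor 1965, proof
of Thm. 9.1; Matsumoto 2001, proof of Thm. 3.35). [cite: Matsumoto2001, proof of Thm. 3.35] -/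
theorem morseIndex_eq_finrank_of_isLocalMax [FiniteDimensional ℝ E] [IsManifold I ∞ M]
    (hf : IsMorse I f) {x : M} (h : IsLocalMax f x) : morseIndex I f x = Module.finrank ℝ E := by
  have hmin : IsLocalMin (fun y => 0 - f y) x := by
    have h' := h.neg
    simp only [zero_sub]
    exact h'
  have h0 : morseIndex I (fun y => 0 - f y) x = 0 :=
    (hf.const_sub 0).morseIndex_eq_zero_of_isLocalMin hmin
  have hadd := hf.morseIndex_const_sub_add 0 (IsLocalMax.isMCriticalPt h)
  omega

end IsMorse

/-! ### Existence of critical points of index `0` and `n` on compact manifolds -/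

variable [CompactSpace M] [Nonempty M]

/-- On a nonempty compact manifold without boundary, a `C²` function has a critical point of
Morse index `0`: any point where it attains its minimum (Matsumoto 2001, proof of Thm. 3.35:
"the number of critical points of index `0` cannot be zero, since `M` is compact"). [cite: Matsumoto2001, proof of Thm. 3.35] -/
theorem exists_isMCriticalPt_morseIndex_eq_zero [FiniteDimensional ℝ E] {f : M → ℝ}
    (hf : ContMDiff I 𝓘(ℝ, ℝ) 2 f) : ∃ x, IsMCriticalPt I f x ∧ morseIndex I f x = 0 := by
  obtain ⟨x, -, hx⟩ := isCompact_univ.exists_isMinOn univ_nonempty hf.continuous.continuousOn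
  have hmin : IsLocalMin f x := hx.isLocalMin univ_mem
  exact ⟨x, IsLocalMin.isMCriticalPt hmin, IsLocalMin.morseIndex_eq_zero (hf x) hmin⟩

namespace IsMorse

variable {f : M → ℝ}

/-- A Morse function on a nonempty compact manifold without boundary has a critical point of
index `0` (its minimum). [cite: Matsumoto2001, proof of Thm. 3.35] -/
theorem criticalSetOfIndex_zero_nonempty (hf : IsMorse I f) :
    (criticalSetOfIndex I f 0).Nonempty := by
  haveI := Manifold.finiteDimensional_of_compactSpace I M
  obtain ⟨x, hx, h0⟩ := exists_isMCriticalPt_morseIndex_eq_zero hf.contMDiff_two'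
  exact ⟨x, hx, h0⟩

/-- A Morse function on a nonempty compact manifold without boundary has a critical point of
index `dim E` (its maximum). [cite: Matsumoto2001, proof of Thm. 3.35] -/
theorem criticalSetOfIndex_finrank_nonempty [IsManifold I ∞ M] (hf : IsMorse I f) :
    (criticalSetOfIndex I f (Module.finrank ℝ E)).Nonempty := by
  haveI := Manifold.finiteDimensional_of_compactSpace I M
  obtain ⟨x, -, hx⟩ := isCompact_univ.exists_isMaxOn univ_nonempty
    hf.contMDiff.continuous.continuousOn
  have hmax : IsLocalMax f x := hx.isLocalMax univ_mem
  exact ⟨x, IsLocalMax.isMCriticalPt hmax, hf.morseIndex_eq_finrank_of_isLocalMax hmax⟩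

variable [IsManifold I ∞ M]

/-- Counted with `Set.ncard`: a Morse function on a nonempty compact manifold without boundary
has at least one critical point of index `0` (the critical set is finite by
`Literature.Topology.FourManifolds.IsMorse.finite_criticalSet_holds`, so `ncard` is the honest count). [cite: Matsumoto2001, proof of Thm. 3.35] -/
theorem one_le_ncard_criticalSetOfIndex_zero (hf : IsMorse I f) :
    1 ≤ (criticalSetOfIndex I f 0).ncard := by
  have hfin : (criticalSetOfIndex I f 0).Finite :=
    (IsMorse.finite_criticalSet_holds hf).subset (criticalSetOfIndex_subset I f 0)
  exact (Set.ncard_pos hfin).2 hf.criticalSetOfIndex_zero_nonempty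

/-- Counted with `Set.ncard`: a Morse function on a nonempty compact manifold without boundary
has at least one critical point of index `dim E`. [cite: Matsumoto2001, proof of Thm. 3.35] -/
theorem one_le_ncard_criticalSetOfIndex_finrank (hf : IsMorse I f) :
    1 ≤ (criticalSetOfIndex I f (Module.finrank ℝ E)).ncard := by
  have hfin : (criticalSetOfIndex I f (Module.finrank ℝ E)).Finite :=
    (IsMorse.finite_criticalSet_holds hf).subset (criticalSetOfIndex_subset I f _)
  exact (Set.ncard_pos hfin).2 hf.criticalSetOfIndex_finrank_nonempty

end IsMorse

end Morse

/-! ### Euclidean model: closed `n`-manifolds -/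

section Euclidean

variable {n : ℕ} {M : Type*} [TopologicalSpace M] [ChartedSpace (EuclideanSpace ℝ (Fin n)) M]
  [IsManifold (𝓡 n) ∞ M] {f : M → ℝ}

/-- Turning about on a closed `n`-manifold: `0 - f` has as many critical points of index `0`
as `f` has of index `n`, and as many of index `n` as `f` has of index `0` ("a `λ`-handle of
`g` becomes an `(m-λ)`-handle of `-g`", Matsumoto 2001, proof of Thm. 3.35; from
`Literature.Topology.FourManifolds.IsMorse.criticalSetOfIndex_const_sub` of `MorseTurnAbout.lean`). [cite: Matsumoto2001, proof of Thm. 3.35] -/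
theorem IsMorse.ncard_criticalSetOfIndex_zero_sub (hf : IsMorse (𝓡 n) f) :
    (criticalSetOfIndex (𝓡 n) (fun y => 0 - f y) 0).ncard = (criticalSetOfIndex (𝓡 n) f n).ncard ∧
      (criticalSetOfIndex (𝓡 n) (fun y => 0 - f y) n).ncard =
        (criticalSetOfIndex (𝓡 n) f 0).ncard := by
  have h0 := hf.criticalSetOfIndex_const_sub 0 (k := 0) (Nat.zero_le _)
  have hn := hf.criticalSetOfIndex_const_sub 0 (k := n) (by rw [finrank_euclideanSpace_fin])
  rw [finrank_euclideanSpace_fin] at h0 hn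
  rw [h0, hn, Nat.sub_zero, Nat.sub_self]
  exact ⟨rfl, rfl⟩

variable [CompactSpace M] [Nonempty M]

/-- On a nonempty closed `n`-manifold a Morse function has at least one critical point of index
`0` and at least one of index `n` (Matsumoto 2001, proof of Thm. 3.35). [cite: Matsumoto2001, proof of Thm. 3.35] -/
theorem IsMorse.one_le_ncard_criticalSetOfIndex_zero_and_self (hf : IsMorse (𝓡 n) f) :
    1 ≤ (criticalSetOfIndex (𝓡 n) f 0).ncard ∧ 1 ≤ (criticalSetOfIndex (𝓡 n) f n).ncard := by
  refine ⟨hf.one_le_ncard_criticalSetOfIndex_zero, ?_⟩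
  have h := hf.one_le_ncard_criticalSetOfIndex_finrank
  rwa [finrank_euclideanSpace_fin] at h

end Euclidean

end Literature.Topology.FourManifolds
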